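import Mathlib.Analysis.SpecialFunctions.Complex.Circle
import Mathlib.Analysis.SpecialFunctions.Trigonometric.Bounds
import Mathlib.Analysis.Real.Pi.Bounds
import Mathlib.Analysis.Complex.Basic
import HarnessLib

/-!
# The peak-normalised Herglotz kernel `((1-r)/(1+r)) (1 + rζ)/(1 - rζ)` on the unit disc

Topic `Literature/Analysis/Complex`. For `0 < r < 1` the Möbius-type function

  `H_r(ζ) = (1 - r)/(1 + r) · (1 + r ζ)/(1 - r ζ)`

is holomorphic on the disc `|ζ| < 1/r ⊋ 𝔻̄`, has positive real part there, is bounded by `1` in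
modulus on the closed unit disc, takes the real value `(1-r)/(1+r)` at the origin, and its real part
on the unit circle is the peak-normalised Poisson kernel

  `Re H_r(e^{iθ}) = (1-r)² / ((1-r)² + 2r(1 - cos θ))`,

a bump of height `1` at `θ = 0` and width `≍ ℓ = 1 - r`, squeezed between the two Lorentzians
`ℓ²/(ℓ² + θ²)` and `ℓ²/(ℓ² + θ²/5)` (`|θ| ≤ π`, `r ≥ 1/2`). These are the standard facts about the
Herglotz–Riesz kernel `(e^{iα} + z)/(e^{iα} - z)` and the Poisson kernel (Rudin, *Real and Complex
Analysis*, §11.5; Garnett, *Bounded Analytic Functions*, Ch. I §3), normalised so that sup and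
conjugate are both `O(1)` uniformly in `r` — the form in which they serve as the boundary profiles
of the analytic discs of `Literature/Analysis/Complex/TubeDiscPropagation.lean` (propagation of
bounds between directions in a tube over a cone). Everything here is elementary and PROVED; no
definitions beyond `peakKernel`. [folklore]

## Mathlib

Used: `Complex.div_re`, `Complex.normSq`, `Real.one_sub_sq_div_two_le_cos`,
`Real.cos_le_one_sub_mul_cos_sq` (Jordan-type bound `cos x ≤ 1 - 2x²/π²` on `[-π, π]`),
`Real.pi_lt_d2` (`π < 3.15`). Mathlib's `herglotzRieszKernel c w z` (`Analysis/Complex/Poisson`) is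
the un-normalised kernel with the pole on a circle of radius `R`; the present normalisation (pole at
`1/r`, value `≤ 1` on `𝔻̄`) is what the disc construction needs, so a separate two-line definition
is used.
-/

noncomputable section

open Complex Metric Set Real

namespace Literature.Analysis.Complex

/-- The **peak-normalised Herglotz kernel** `H_r(ζ) = (1-r)/(1+r) · (1 + rζ)/(1 - rζ)`: real part
on the unit circle `= (1-r)²/((1-r)² + 2r(1 - cos θ))`, the Poisson kernel normalised to peak value
`1`. [folklore] -/
def peakKernel (r : ℝ) (ζ : ℂ) : ℂ :=
  (((1 - r) / (1 + r) : ℝ) : ℂ) * ((1 + r * ζ) / (1 - r * ζ))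

variable {r : ℝ} {ζ : ℂ}

/-- `1 - rζ ≠ 0` for `|ζ| < 1/r`. [folklore] -/
theorem one_sub_mul_ne_zero (hr : 0 < r) (hζ : ‖ζ‖ < r⁻¹) : (1 : ℂ) - r * ζ ≠ 0 := by
  intro h
  have h1 : (r : ℂ) * ζ = 1 := by linear_combination -h
  have h2 : ‖(r : ℂ) * ζ‖ = 1 := by rw [h1, norm_one]
  rw [norm_mul, Complex.norm_real, Real.norm_eq_abs, abs_of_pos hr] at h2
  have h3 : r * ‖ζ‖ < r * r⁻¹ := mul_lt_mul_of_pos_left hζ hr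
  rw [mul_inv_cancel₀ hr.ne'] at h3
  linarith

/-- `‖rζ‖ < 1` for `|ζ| < 1/r`. [folklore] -/
theorem norm_mul_lt_one (hr : 0 < r) (hζ : ‖ζ‖ < r⁻¹) : ‖(r : ℂ) * ζ‖ < 1 := by
  rw [norm_mul, Complex.norm_real, Real.norm_eq_abs, abs_of_pos hr]
  calc r * ‖ζ‖ < r * r⁻¹ := mul_lt_mul_of_pos_left hζ hr
    _ = 1 := mul_inv_cancel₀ hr.ne'

/-- **Holomorphy**: `H_r` is complex differentiable on the disc `|ζ| < 1/r`. [folklore] -/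
theorem differentiableOn_peakKernel (hr : 0 < r) :
    DifferentiableOn ℂ (peakKernel r) (ball (0 : ℂ) r⁻¹) := by
  intro ζ hζ
  rw [mem_ball_zero_iff] at hζ
  refine DifferentiableAt.differentiableWithinAt ?_
  unfold peakKernel
  refine (differentiableAt_const _).mul ?_
  refine DifferentiableAt.div ?_ ?_ (one_sub_mul_ne_zero hr hζ)
  · exact (differentiableAt_const _).add ((differentiableAt_const _).mul differentiableAt_id)
  · exact (differentiableAt_const _).sub ((differentiableAt_const _).mul differentiableAt_id)

/-- `H_r` is differentiable at every point of the disc `|ζ| < 1/r`. [folklore] -/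
theorem differentiableAt_peakKernel (hr : 0 < r) (hζ : ‖ζ‖ < r⁻¹) :
    DifferentiableAt ℂ (peakKernel r) ζ :=
  (differentiableOn_peakKernel hr).differentiableAt (isOpen_ball.mem_nhds (mem_ball_zero_iff.2 hζ))

/-- **Value at the centre**: `H_r(0) = (1-r)/(1+r)`. [folklore] -/
theorem peakKernel_zero : peakKernel r 0 = (((1 - r) / (1 + r) : ℝ) : ℂ) := by
  simp [peakKernel]

/-- The centre value is real: `Im H_r(0) = 0`. [folklore] -/
theorem peakKernel_zero_im : (peakKernel r 0).im = 0 := by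
  rw [peakKernel_zero, ofReal_im]

/-- `Re H_r(0) = (1-r)/(1+r)`. [folklore] -/
theorem peakKernel_zero_re : (peakKernel r 0).re = (1 - r) / (1 + r) := by
  rw [peakKernel_zero, ofReal_re]

/-- For `0 ≤ r < 1`: `(1-r)/2 ≤ H_r(0) ≤ 1 - r`, i.e. the centre value is comparable to the width
`ℓ = 1 - r`. [folklore] -/
theorem peakKernel_zero_re_le (hr0 : 0 ≤ r) (hr1 : r < 1) :
    (1 - r) / 2 ≤ (peakKernel r 0).re ∧ (peakKernel r 0).re ≤ 1 - r := by
  rw [peakKernel_zero_re]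
  have h1 : 0 < 1 + r := by linarith
  constructor
  · rw [div_le_div_iff₀ two_pos h1]; nlinarith
  · rw [div_le_iff₀ h1]; nlinarith

/-- **`|H_r| ≤ 1` on the closed unit disc** (`|1 + rζ| ≤ 1 + r`, `|1 - rζ| ≥ 1 - r`). [folklore] -/
theorem norm_peakKernel_le_one (hr0 : 0 < r) (hr1 : r < 1) (hζ : ‖ζ‖ ≤ 1) :
    ‖peakKernel r ζ‖ ≤ 1 := by
  have hrζ : ‖(r : ℂ) * ζ‖ ≤ r := by
    rw [norm_mul, Complex.norm_real, Real.norm_eq_abs, abs_of_pos hr0]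
    exact mul_le_of_le_one_right hr0.le hζ
  have hnum : ‖(1 : ℂ) + r * ζ‖ ≤ 1 + r :=
    (norm_add_le _ _).trans (by rw [norm_one]; linarith)
  have hden : 1 - r ≤ ‖(1 : ℂ) - r * ζ‖ := by
    have := norm_sub_norm_le (1 : ℂ) (r * ζ)
    rw [norm_one] at this
    linarith [abs_sub_abs_le_abs_sub ‖(1 : ℂ)‖ ‖(r : ℂ) * ζ‖]
  have hden0 : 0 < ‖(1 : ℂ) - r * ζ‖ := lt_of_lt_of_le (by linarith) hden
  unfold peakKernel
  rw [norm_mul, Complex.norm_real, Real.norm_eq_abs, abs_of_pos (by positivity), norm_div]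
  rw [div_mul_div_comm, div_le_one (by positivity)]
  calc (1 - r) * ‖(1 : ℂ) + r * ζ‖ ≤ (1 - r) * (1 + r) :=
        mul_le_mul_of_nonneg_left hnum (by linarith)
    _ = (1 + r) * (1 - r) := by ring
    _ ≤ (1 + r) * ‖(1 : ℂ) - r * ζ‖ := mul_le_mul_of_nonneg_left hden (by linarith)

/-- Real part of the Cayley-type quotient: `Re ((1+w)/(1-w)) = (1 - |w|²)/|1 - w|²`. [folklore] -/
theorem re_one_add_div_one_sub (w : ℂ) (hw : (1 : ℂ) - w ≠ 0) :
    ((1 + w) / (1 - w)).re = (1 - normSq w) / normSq (1 - w) := by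
  rw [Complex.div_re]
  have hn : normSq (1 - w) ≠ 0 := by rwa [Ne, normSq_eq_zero]
  field_simp
  simp only [add_re, one_re, sub_re, add_im, one_im, sub_im, zero_sub, normSq_apply]
  ring

/-- **Positive real part**: `Re H_r(ζ) > 0` for `|ζ| < 1/r` (`0 < r < 1`). [folklore] -/
theorem peakKernel_re_pos (hr0 : 0 < r) (hr1 : r < 1) (hζ : ‖ζ‖ < r⁻¹) :
    0 < (peakKernel r ζ).re := by
  have hne := one_sub_mul_ne_zero hr0 hζ
  have hw1 : normSq ((r : ℂ) * ζ) < 1 := by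
    rw [normSq_eq_norm_sq]
    have h := norm_mul_lt_one hr0 hζ
    have h0 : 0 ≤ ‖(r : ℂ) * ζ‖ := norm_nonneg _
    nlinarith
  unfold peakKernel
  rw [re_ofReal_mul]
  refine mul_pos (div_pos (by linarith) (by linarith)) ?_
  rw [re_one_add_div_one_sub _ hne]
  exact div_pos (by linarith) (normSq_pos.2 hne)

/-- `0 ≤ Re H_r(ζ) ≤ 1` on the closed unit disc. [folklore] -/
theorem peakKernel_re_mem_Icc (hr0 : 0 < r) (hr1 : r < 1) (hζ : ‖ζ‖ ≤ 1) :
    (peakKernel r ζ).re ∈ Icc (0 : ℝ) 1 := by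
  have hlt : ‖ζ‖ < r⁻¹ := lt_of_le_of_lt hζ ((one_lt_inv₀ hr0).2 hr1)
  exact ⟨(peakKernel_re_pos hr0 hr1 hlt).le,
    (Complex.re_le_norm _).trans (norm_peakKernel_le_one hr0 hr1 hζ)⟩

/-- `|Im H_r(ζ)| ≤ 1` on the closed unit disc (the conjugate profile is `O(1)` uniformly in `r`).
[folklore] -/
theorem abs_peakKernel_im_le_one (hr0 : 0 < r) (hr1 : r < 1) (hζ : ‖ζ‖ ≤ 1) :
    |(peakKernel r ζ).im| ≤ 1 :=
  (Complex.abs_im_le_norm _).trans (norm_peakKernel_le_one hr0 hr1 hζ)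

/-! ### The boundary profile: the peak-normalised Poisson kernel -/

/-- `|1 - r e^{iθ}|² = (1-r)² + 2r(1 - cos θ)`. [folklore] -/
theorem normSq_one_sub_mul_exp (r θ : ℝ) :
    normSq (1 - (r : ℂ) * exp (θ * I)) = (1 - r) ^ 2 + 2 * r * (1 - Real.cos θ) := by
  rw [normSq_apply]
  simp only [sub_re, one_re, mul_re, ofReal_re, ofReal_im, zero_mul, sub_zero, sub_im, one_im,
    mul_im, add_zero, zero_sub, exp_ofReal_mul_I_re, exp_ofReal_mul_I_im]
  linear_combination r ^ 2 * Real.sin_sq_add_cos_sq θ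

/-- **The boundary values**: `Re H_r(e^{iθ}) = (1-r)²/((1-r)² + 2r(1 - cos θ))`, the Poisson kernel
normalised to peak `1` (Rudin, *Real and Complex Analysis*, §11.5 (2)). [folklore] -/
theorem peakKernel_exp_re (hr0 : 0 < r) (hr1 : r < 1) (θ : ℝ) :
    (peakKernel r (exp (θ * I))).re = (1 - r) ^ 2 / ((1 - r) ^ 2 + 2 * r * (1 - Real.cos θ)) := by
  have hζ : ‖exp (θ * I)‖ < r⁻¹ := by
    rw [norm_exp_ofReal_mul_I]; exact (one_lt_inv₀ hr0).2 hr1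
  have hne := one_sub_mul_ne_zero hr0 hζ
  unfold peakKernel
  rw [re_ofReal_mul, re_one_add_div_one_sub _ hne, normSq_one_sub_mul_exp]
  have hw : normSq ((r : ℂ) * exp (θ * I)) = r ^ 2 := by
    rw [normSq_eq_norm_sq, norm_mul, Complex.norm_real, norm_exp_ofReal_mul_I, mul_one,
      Real.norm_eq_abs, sq_abs]
  rw [hw]
  have h1 : 0 < 1 + r := by linarith
  have hD : 0 < (1 - r) ^ 2 + 2 * r * (1 - Real.cos θ) := by
    have := Real.cos_le_one θ
    have h2 : 0 < (1 - r) ^ 2 := by apply pow_pos; linarith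
    nlinarith
  field_simp
  ring

/-- **Lorentzian lower bound**: `Re H_r(e^{iθ}) ≥ ℓ²/(ℓ² + θ²)`, `ℓ = 1 - r`
(from `1 - cos θ ≤ θ²/2` and `r ≤ 1`). [folklore] -/
theorem lorentz_le_peakKernel_exp_re (hr0 : 0 < r) (hr1 : r < 1) (θ : ℝ) :
    (1 - r) ^ 2 / ((1 - r) ^ 2 + θ ^ 2) ≤ (peakKernel r (exp (θ * I))).re := by
  rw [peakKernel_exp_re hr0 hr1]
  have hℓ : 0 < (1 - r) ^ 2 := by apply pow_pos; linarith
  have hcos : 1 - Real.cos θ ≤ θ ^ 2 / 2 := by linarith [Real.one_sub_sq_div_two_le_cos (x := θ)]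
  have hcos0 : 0 ≤ 1 - Real.cos θ := by linarith [Real.cos_le_one θ]
  have hD : 0 < (1 - r) ^ 2 + 2 * r * (1 - Real.cos θ) := by nlinarith
  apply div_le_div_of_nonneg_left hℓ.le hD
  nlinarith

/-- **Lorentzian upper bound**: `Re H_r(e^{iθ}) ≤ ℓ²/(ℓ² + θ²/5)` for `|θ| ≤ π` and `r ≥ 1/2`
(from Jordan's `1 - cos θ ≥ 2θ²/π²` and `π² < 10`). [folklore] -/
theorem peakKernel_exp_re_le_lorentz (hr0 : (1 : ℝ) / 2 ≤ r) (hr1 : r < 1) {θ : ℝ} (hθ : |θ| ≤ π) :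
    (peakKernel r (exp (θ * I))).re ≤ (1 - r) ^ 2 / ((1 - r) ^ 2 + θ ^ 2 / 5) := by
  have hr0' : 0 < r := by linarith
  rw [peakKernel_exp_re hr0' hr1]
  have hℓ : 0 < (1 - r) ^ 2 := by apply pow_pos; linarith
  have hJ : 2 / π ^ 2 * θ ^ 2 ≤ 1 - Real.cos θ := by
    linarith [Real.cos_le_one_sub_mul_cos_sq hθ]
  have hpi : π ^ 2 < 10 := by nlinarith [Real.pi_lt_d2, Real.pi_pos]
  have hθ2 : 0 ≤ θ ^ 2 := sq_nonneg θ
  have hkey : θ ^ 2 / 5 ≤ 2 * r * (1 - Real.cos θ) := by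
    have h1 : θ ^ 2 / 5 ≤ 2 / π ^ 2 * θ ^ 2 := by
      rw [div_le_iff₀ (by norm_num : (0 : ℝ) < 5), mul_comm, ← mul_assoc]
      have : (1 : ℝ) ≤ 5 * (2 / π ^ 2) := by
        rw [mul_div_assoc', le_div_iff₀ (by positivity)]; linarith
      nlinarith
    have h2 : 2 / π ^ 2 * θ ^ 2 ≤ 2 * r * (1 - Real.cos θ) := by
      have h3 : 0 ≤ 1 - Real.cos θ := by linarith [Real.cos_le_one θ]
      nlinarith
    linarith
  have hD : 0 < (1 - r) ^ 2 + θ ^ 2 / 5 := by positivity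
  apply div_le_div_of_nonneg_left hℓ.le hD
  linarith

/-- A point of the unit circle is `e^{iθ}` with `θ = arg ζ ∈ (-π, π]`, `|θ| ≤ π`. [folklore] -/
theorem exists_eq_exp_of_norm_eq_one (hζ : ‖ζ‖ = 1) :
    ∃ θ : ℝ, |θ| ≤ π ∧ ζ = exp (θ * I) := by
  refine ⟨arg ζ, abs_arg_le_pi ζ, ?_⟩
  have h := norm_mul_exp_arg_mul_I ζ
  rw [hζ, ofReal_one, one_mul] at h
  exact h.symm

/-- **Dichotomy on the unit circle** in the form used by the disc construction: at a point `ζ` of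
the unit circle, either the peak kernel is at least `1/Q`, or else `ζ = e^{iθ}` with
`θ² > (Q - 1) ℓ²` (`ℓ = 1 - r`) — the point is far out in the tail, where the Lorentzian bounds
apply. [folklore] -/
theorem peakKernel_re_ge_or_far (hr0 : 0 < r) (hr1 : r < 1) {Q : ℝ} (hQ : 0 < Q) (hζ : ‖ζ‖ = 1) :
    (1 / Q ≤ (peakKernel r ζ).re) ∨
      ∃ θ : ℝ, |θ| ≤ π ∧ ζ = exp (θ * I) ∧ (Q - 1) * (1 - r) ^ 2 < θ ^ 2 := by
  obtain ⟨θ, hθ, rfl⟩ := exists_eq_exp_of_norm_eq_one hζ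
  by_cases h : 1 / Q ≤ (peakKernel r (exp (θ * I))).re
  · exact Or.inl h
  · refine Or.inr ⟨θ, hθ, rfl, ?_⟩
    push Not at h
    have hL := lorentz_le_peakKernel_exp_re hr0 hr1 θ
    have hℓ : 0 < (1 - r) ^ 2 := by apply pow_pos; linarith
    have hD : 0 < (1 - r) ^ 2 + θ ^ 2 := by positivity
    have h2 : (1 - r) ^ 2 / ((1 - r) ^ 2 + θ ^ 2) < 1 / Q := hL.trans_lt h
    rw [div_lt_div_iff₀ hD hQ] at h2
    nlinarith

end Literature.Analysis.Complex
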